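import Summits.QuantumFields.BalabanUV.Beta.GAN24.ConstantBackgroundVolumeLimit

/-!
# `BalabanUV.Beta.GAN24.PerturbedPropagatorVolumeLimit` — binder row G-an2-4 ∕ (CONV-C), route R7 «TWO CURRENCIES», PART 151: `U ≠ 1` BEYOND FIRST ORDER — THE PERTURBED FINE
# PROPAGATOR `(Δ_a^{(k)} + u·P(V_t)^{(k)})⁻¹` AND THE PERTURBED BLOCK COVARIANCE `c_k(u) = L^{dk}Q_k(Δ_a^{(k)} + uP^{(k)})⁻¹Q_kᴴ` HAVE PAIR ENTRY LIMITS ON `ℤ^d`, MODULO ONLY THE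
# BACKGROUND's POINTWISE LIMIT.  PART 129 proved (UD)+(SR) for the effective form WITH background `Σ_k(u) = c_k(u)⁻¹ − a″·1` on a coupling disc, volume-free; its `ℤ^d` END (PART 152)
# needs the entry limits.  Route (all orders in `u`, no expansion): `Δ_a + uP = (1 + u·P𝒢)·Δ_a` (NE2's `add_smul_eq_mul_right`), so `(Δ_a + uP)⁻¹ = 𝒢·(1 + u·P𝒢)⁻¹`; the local
# operator `P = Σ_μ diag(V_μ)∇_μ` acts on the LEFT index of `𝒢` by an explicit two-point stencil (§1 `Pmodel_mul_apply`), so `P𝒢` inherits `𝒢`'s volume-free fine window decay (PART 145)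
# and its pair entry limits (PART 146 + EL₁ of `V_t`); `‖u·P𝒢‖ ≤ ‖u‖κ₀ < 1` (NE2's (H-bd)); hence PART 144's `exists_tendsto_inv_pair` (inverses WITHOUT translation invariance, fibre
# `Fin d`) gives EL₂ of `(1 + u·P𝒢)⁻¹`, PART 144's pair products give EL₂ of `𝒢·(1 + u·P𝒢)⁻¹`, and PART 138's stencil lifts it to `c_k(u)` on the unit lattice (unit b2b-balaban-gan24-p3, gen 55; v1)

NOT IN PRINT; OUR PROOF ([folklore] bookkeeping BY NAME over PART 144 (`exists_tendsto_inv_pair`, `tendsto_mul_pair'`, `norm_one_sub_smul_apply_le`, `tendsto_one_sub_smul_pair`), PART 145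
(`exists_fineWindowDecay_calGlev`), PART 146 (`tendsto_calGlev_pair`, `reindex_avgTow_eq`), PART 142 (`l1_windowMap_sub_castT_ge`, `l1_windowMap_neg`), PART 138 (`QGQ_apply`,
`bpt_castT_add_tstep`), NE2's `FirstOrderBackgroundModel` (`LipschitzBackground`, `Pmodel`, `perturbationLaws_firstOrder`), `BackgroundResolventLaw` (`add_smul_eq_mul_right`,
`opNorm_smul_le_of_le`, `opNorm_inv_one_add_le`), `KingPairingPlantedLaw` (`calDalev_inv`, `isUnit_det_calDalev`), `BalabanAveragedTowerUnit.norm_entry_le_opNorm`, b05's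
`B5Prop11Plancherel` (`fdiff`, `shiftM`, `unitVec`), an5's `VectorTailsPt.shiftM_mul_apply`; [Balaban1987RG1] (1.21)–(1.22) p. 264 LOCATE the shapes; nothing printed is a hypothesis).
HONEST FRAMING (cell contract, verbatim): «discharging `BetaPertH` makes Bałaban's UV stability UNCONDITIONAL — a real constructive-QFT result; it is NOT the
continuum limit and NOT the Clay problem.»  HONEST DEPENDENCY (verbatim): «continuum YM on T⁴ ⇐ BetaPertH ∧ nine spine estimates (0/9 proved); BetaPertH ⇐
(D1) ∧ (D4) ∧ CAP+tail; G-an2-4 gates asym, D1 and NE2/3/4.»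

WHAT THIS FILE PROVES (0 sorry, 0 `def`; `n_k = L^k`, `κ₀ = d(α+β)Cst`, `ẑ_t` the fine reading of `z ∈ ℤ^d`; EL₁ ∕ EL₂ = convergence at every fine integer point ∕ pair along `t → ∞`):
* §1 `fdiff_mul_apply`, **`Pmodel_mul_apply`** (`(P(V)^{(k)}·G)(i,j) = Σ_μ V_μ(i)·n_k·(G(i + e_μ, j) − G(i, j))`), `l1_neg_single`, `l1_windowMap_add_unitVec_ge`
  (`|windowMap v|₁ − 3 ≤ |windowMap (v + e_μ)|₁`), **`norm_Pmodel_mul_apply_le`** (a fine-window-decaying `G` gives a fine-window-decaying `P(V)·G`, constant `d·α·n_k·(e^{3δ}+1)·C`, same rate).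
* §2 **`tendsto_Pmodel_mul_pair`** (any `side t → ∞`: EL₁ of `V_t` at level `k` + EL₂ of `G_t` ⟹ EL₂ of `P(V_t)^{(k)}·G_t`).
* §3 `pertInv_eq` (`(Δ_a^{(k)} + uP)⁻¹ = 𝒢^{(k)}·(1 + u·P𝒢^{(k)})⁻¹`), `one_sub_one_smul`, **`tendsto_pertInv_pair`** — `d ≥ 3`, even cubic volumes, Lipschitz backgrounds `(α, β)` uniform in the
  volume, `‖u‖ ≤ T`, `T·κ₀ < 1`, EL₁ of `V_t` at level `k` ⟹ EL₂ of `(Δ_a^{(k)} + u·P(V_t)^{(k)})⁻¹` at fine integer pairs.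
* §4 **`tendsto_avgTow_pair_of_fine`** (GENERIC: EL₂ of ANY middle tower `X_t k` at fine pairs ⟹ EL₂ of `L^{dk}Q_kX_tQ_kᴴ` read on the unit lattice — PART 146's stencil argument made
  middle-free), **`tendsto_pertCov_pair`** (EL₂ of `c_k(u)` at unit integer pairs, same hypotheses as §3).
WHAT IT DOES NOT DO: the inverse `c_k(u)⁻¹` and the END (PART 152); `d ≤ 2` ∕ odd volumes (inherited from an5's `calG_tendsto_Kinf`); large couplings; Bałaban's shaped `P_B`; second
u-derivatives.  SUPPLIER work; NEVER «G-an2-4 closed»; NOT (CONV-C), NOT D1, NOT `BetaPertH`, NOT continuum, NOT Clay.  Records: `HOME/b2b-balaban-gan24-p3/gen55/README.md`.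
-/

noncomputable section

open scoped BigOperators ComplexConjugate Matrix Matrix.Norms.L2Operator
open Filter Topology

namespace Summit.QuantumFields.BalabanUV.Beta.GAN24.PerturbedPropagatorVolumeLimit

open Literature.MathematicalPhysics.QuantumFieldTheory.Balaban1983to89
open Literature.MathematicalPhysics.QuantumFieldTheory.Balaban1983to89.B5Prop11Plancherel (Tor fine fdiff shiftM unitVec Cst Cst_nonneg)
open Literature.MathematicalPhysics.QuantumFieldTheory.Balaban1983to89.B5Block118 (QvOp bpt tstep)
open Literature.MathematicalPhysics.QuantumFieldTheory.Balaban1983to89.B5G183RateUnitTower (lev)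
open Literature.MathematicalPhysics.QuantumFieldTheory.Balaban1983to89.B12Sec2to5 (l1)
open Literature.MathematicalPhysics.QuantumFieldTheory.Balaban1983to89.Beta (Site windowMap)
open Literature.MathematicalPhysics.QuantumFieldTheory.Balaban1983to89.Beta.FreeLegDictionary (cubic)
open Literature.MathematicalPhysics.QuantumFieldTheory.Balaban1983to89.Beta.BlockKernelVolumeSockets (evenPeriod tendsto_evenPeriod)
open Literature.MathematicalPhysics.QuantumFieldTheory.Balaban1983to89.Beta.VectorTails (castT castT_add castT_neg castT_single)
open Literature.MathematicalPhysics.QuantumFieldTheory.Balaban1983to89.Beta.VectorTailsPt (shiftM_mul_apply)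
open Summit.QuantumFields.BalabanUV.T4Continuum
open Summit.QuantumFields.BalabanUV.T4Continuum.CovariantAveragingTower (avgTow)
open Summit.QuantumFields.BalabanUV.T4Continuum.BalabanAveragedTowerUnit (idx QBlev calGlev one_le_lev' norm_entry_le_opNorm)
open Summit.QuantumFields.BalabanUV.T4Continuum.BalabanAveragedCoerciveTower (unitIdx)
open Summit.QuantumFields.BalabanUV.T4Continuum.KingPairingPlantedLaw (calDalev calDalev_inv isUnit_det_calDalev)
open Summit.QuantumFields.BalabanUV.T4Continuum.FirstOrderBackgroundModel (LipschitzBackground Pmodel firstOrder perturbationLaws_firstOrder)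
open Summit.QuantumFields.BalabanUV.T4Continuum.BackgroundResolventLaw (add_smul_eq_mul_right opNorm_smul_le_of_le opNorm_inv_one_add_le)
open Summit.QuantumFields.BalabanUV.Beta.GAN24.VolumeLimitCovariance (QGQ_apply bpt_castT_add_tstep)
open Summit.QuantumFields.BalabanUV.Beta.GAN24.DiagramVolumeLimitPairs (l1_windowMap_sub_castT_ge l1_windowMap_neg)
open Summit.QuantumFields.BalabanUV.Beta.GAN24.VolumeLimitPairsFibre (tendsto_mul_pair' exists_tendsto_inv_pair norm_one_sub_smul_apply_le tendsto_one_sub_smul_pair)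
open Summit.QuantumFields.BalabanUV.Beta.GAN24.FinePropagatorDecay (exists_fineWindowDecay_calGlev)
open Summit.QuantumFields.BalabanUV.Beta.GAN24.FineInsertionVolumeLimit (tendsto_calGlev_pair reindex_avgTow_eq)

variable {d : ℕ} (L : ℕ) [NeZero L]

/-! ## §1 The first-order coupling acts on the left index by a two-point stencil; fine window decay of `P·G` -/

section Stencil

variable (N : Fin d → ℕ) [hN : ∀ μ, NeZero (N μ)]

/-- `(∇_ν·G)(i, j) = c·(G((i₁ + e_ν, i₂), j) − G(i, j))`. [folklore] -/
theorem fdiff_mul_apply (c : ℂ) (ν : Fin d) (G : Matrix (Tor N × Fin d) (Tor N × Fin d) ℂ) (i j : Tor N × Fin d) :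
    (fdiff N c ν * G) i j = c * (G (i.1 + unitVec N ν, i.2) j - G i j) := by
  rw [fdiff, Matrix.smul_mul, Matrix.sub_mul, Matrix.one_mul, Matrix.smul_apply, Matrix.sub_apply, shiftM_mul_apply, smul_eq_mul]

end Stencil

section Model

variable (M : Fin d → ℕ) [hM : ∀ μ, NeZero (M μ)]

/-- **`Pmodel_mul_apply` — THE FIRST-ORDER COUPLING ACTS ON THE LEFT INDEX BY A TWO-POINT STENCIL**: `(P(V)^{(k)}·G)(i, j) = Σ_μ V^{(k)}_μ(i)·n_k·(G((i₁ + e_μ, i₂), j) − G(i, j))`.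
[folklore] -/
theorem Pmodel_mul_apply (V : (k : ℕ) → Fin d → (idx L M k → ℂ)) (k : ℕ) (G : Matrix (idx L M k) (idx L M k) ℂ) (i j : idx L M k) :
    (Pmodel L M V k * G) i j = ∑ μ, V k μ i * (((lev L k : ℕ) : ℂ) * (G (i.1 + unitVec (fine (lev L k) M) μ, i.2) j - G i j)) := by
  unfold Pmodel firstOrder
  rw [Finset.sum_mul, Matrix.sum_apply]
  refine Finset.sum_congr rfl fun μ _ => ?_
  rw [Matrix.mul_assoc, Matrix.diagonal_mul, fdiff_mul_apply]

end Model

section Window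

omit [NeZero L] in
/-- `|−e_μ|₁ = 1`. [folklore] -/
theorem l1_neg_single (μ : Fin d) : l1 (-(Pi.single μ (1 : ℤ) : Fin d → ℤ)) = 1 := by
  unfold l1
  rw [Finset.sum_eq_single μ]
  · simp
  · intro b _ hb
    simp [hb]
  · intro h; exact absurd (Finset.mem_univ _) h

omit [NeZero L] in
/-- **`l1_windowMap_add_unitVec_ge`**: `|windowMap v|₁ − 3 ≤ |windowMap (v + e_μ)|₁` on the cubic torus `(ℤ∕s)^d` (PART 142's `l1_windowMap_sub_castT_ge` at `z = −e_μ`). [folklore] -/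
theorem l1_windowMap_add_unitVec_ge (s : ℕ) [NeZero s] (v : Site d s) (μ : Fin d) :
    l1 (windowMap d s v) - 3 ≤ l1 (windowMap d s (v + unitVec (cubic d s) μ)) := by
  have h := l1_windowMap_sub_castT_ge s v (-(Pi.single μ (1 : ℤ)))
  have e : v - castT (cubic d s) (-(Pi.single μ (1 : ℤ))) = v + unitVec (cubic d s) μ := by
    rw [castT_neg, castT_single, sub_neg_eq_add]; rfl
  rw [l1_neg_single, mul_one, e] at h
  exact h

/-- **`norm_Pmodel_mul_apply_le` — `P(V)·G` DECAYS LIKE `G` IN THE FINE WINDOW** [folklore]: on the fine torus of the cubic volume `(ℤ∕s)^d` at level `k` (side `n_k·s`), if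
`‖G((w,g),(y,h))‖ ≤ C·e^{−δ|windowMap(w − y)|₁}` (`C, δ ≥ 0`) and `V` is a background of size `≤ α` (`LipschitzBackground`, only the size is used), then
`‖(P(V)^{(k)}·G)((w,g),(y,h))‖ ≤ d·(α·n_k·((e^{3δ} + 1)·C))·e^{−δ|windowMap(w − y)|₁}`. -/
theorem norm_Pmodel_mul_apply_le (s : ℕ) [NeZero s] {V : (k : ℕ) → Fin d → (idx L (cubic d s) k → ℂ)} {α β : ℝ} (hV : LipschitzBackground L (cubic d s) V α β) (k : ℕ)
    {G : Matrix (idx L (cubic d s) k) (idx L (cubic d s) k) ℂ} {C δ : ℝ} (hC : 0 ≤ C) (hδ : 0 ≤ δ)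
    (hG : ∀ (w : Site d (lev L k * s)) (g : Fin d) (y : Site d (lev L k * s)) (h : Fin d), ‖G (w, g) (y, h)‖ ≤ C * Real.exp (-δ * l1 (windowMap d (lev L k * s) (w - y))))
    (w : Site d (lev L k * s)) (g : Fin d) (y : Site d (lev L k * s)) (h : Fin d) :
    ‖(Pmodel L (cubic d s) V k * G) (w, g) (y, h)‖ ≤ d * (α * lev L k * ((Real.exp (3 * δ) + 1) * C)) * Real.exp (-δ * l1 (windowMap d (lev L k * s) (w - y))) := by
  rw [Pmodel_mul_apply]
  have hα0 : 0 ≤ α := hV.nonneg.1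
  calc ‖∑ μ, V k μ (w, g) * (((lev L k : ℕ) : ℂ) * (G (w + unitVec (fine (lev L k) (cubic d s)) μ, g) (y, h) - G (w, g) (y, h)))‖
      ≤ ∑ μ, ‖V k μ (w, g) * (((lev L k : ℕ) : ℂ) * (G (w + unitVec (fine (lev L k) (cubic d s)) μ, g) (y, h) - G (w, g) (y, h)))‖ := norm_sum_le _ _
    _ ≤ ∑ _μ : Fin d, α * lev L k * ((Real.exp (3 * δ) + 1) * C) * Real.exp (-δ * l1 (windowMap d (lev L k * s) (w - y))) := by
        refine Finset.sum_le_sum fun μ _ => ?_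
        rw [norm_mul, norm_mul, Complex.norm_natCast]
        have h1 := hV.bound k μ (w, g)
        have h2 : ‖G (w + unitVec (fine (lev L k) (cubic d s)) μ, g) (y, h) - G (w, g) (y, h)‖
            ≤ ((Real.exp (3 * δ) + 1) * C) * Real.exp (-δ * l1 (windowMap d (lev L k * s) (w - y))) := by
          refine (norm_sub_le _ _).trans ?_
          have ha := hG (w + unitVec (fine (lev L k) (cubic d s)) μ) g y h
          have hb := hG w g y h
          have e1 : w + unitVec (fine (lev L k) (cubic d s)) μ - y = (w - y) + unitVec (cubic d (lev L k * s)) μ := by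
            rw [add_sub_right_comm]
          have hwin := l1_windowMap_add_unitVec_ge (lev L k * s) (w - y) μ
          have hexp : Real.exp (-δ * l1 (windowMap d (lev L k * s) (w + unitVec (fine (lev L k) (cubic d s)) μ - y)))
              ≤ Real.exp (3 * δ) * Real.exp (-δ * l1 (windowMap d (lev L k * s) (w - y))) := by
            rw [e1, ← Real.exp_add]
            exact Real.exp_le_exp.mpr (by nlinarith)
          calc ‖G (w + unitVec (fine (lev L k) (cubic d s)) μ, g) (y, h)‖ + ‖G (w, g) (y, h)‖
              ≤ C * (Real.exp (3 * δ) * Real.exp (-δ * l1 (windowMap d (lev L k * s) (w - y)))) + C * Real.exp (-δ * l1 (windowMap d (lev L k * s) (w - y))) :=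
                add_le_add (ha.trans (mul_le_mul_of_nonneg_left hexp hC)) hb
            _ = ((Real.exp (3 * δ) + 1) * C) * Real.exp (-δ * l1 (windowMap d (lev L k * s) (w - y))) := by ring
        calc ‖V k μ (w, g)‖ * ((lev L k : ℝ) * ‖G (w + unitVec (fine (lev L k) (cubic d s)) μ, g) (y, h) - G (w, g) (y, h)‖)
            ≤ α * ((lev L k : ℝ) * (((Real.exp (3 * δ) + 1) * C) * Real.exp (-δ * l1 (windowMap d (lev L k * s) (w - y))))) :=
              mul_le_mul h1 (mul_le_mul_of_nonneg_left h2 (Nat.cast_nonneg _)) (by positivity) hα0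
          _ = α * lev L k * ((Real.exp (3 * δ) + 1) * C) * Real.exp (-δ * l1 (windowMap d (lev L k * s) (w - y))) := by ring
    _ = d * (α * lev L k * ((Real.exp (3 * δ) + 1) * C)) * Real.exp (-δ * l1 (windowMap d (lev L k * s) (w - y))) := by
        rw [Finset.sum_const, Finset.card_univ, Fintype.card_fin, nsmul_eq_mul]; ring

end Window

/-! ## §2 EL₂ of `P(V_t)·G_t` from EL₁ of the background and EL₂ of `G_t`, along any volume sequence -/

section AnyVolume

variable {side : ℕ → ℕ} [∀ t, NeZero (side t)]

omit [∀ t, NeZero (side t)] in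
/-- **`tendsto_Pmodel_mul_pair`** [folklore]: along `side t → ∞`, at level `k`: EL₁ of `V_t` (`∀ μ f z, ∃ s, V_t k μ (ẑ_t, f) → s`) and EL₂ of `G_t` ⟹ EL₂ of `P(V_t)^{(k)}·G_t` — by
§1's stencil, the reading of `z + e_μ` being `ẑ_t + e_μ`. -/
theorem tendsto_Pmodel_mul_pair [∀ t, NeZero (side t)] (k : ℕ) (V : (t : ℕ) → (k : ℕ) → Fin d → (idx L (cubic d (side t)) k → ℂ))
    (hV : ∀ (μ f : Fin d) (z : Fin d → ℤ), ∃ s : ℂ, Tendsto (fun t => V t k μ (castT (cubic d (lev L k * side t)) z, f)) atTop (𝓝 s))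
    {G : (t : ℕ) → Matrix (idx L (cubic d (side t)) k) (idx L (cubic d (side t)) k) ℂ}
    (hG : ∀ (f g : Fin d) (z z' : Fin d → ℤ), ∃ s : ℂ, Tendsto (fun t => G t (castT (cubic d (lev L k * side t)) z, f) (castT (cubic d (lev L k * side t)) z', g)) atTop (𝓝 s))
    (f g : Fin d) (z z' : Fin d → ℤ) :
    ∃ s : ℂ, Tendsto (fun t => (Pmodel L (cubic d (side t)) (V t) k * G t) (castT (cubic d (lev L k * side t)) z, f) (castT (cubic d (lev L k * side t)) z', g)) atTop (𝓝 s) := by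
  choose sV hsV using hV
  choose sG hsG using hG
  refine ⟨∑ μ, sV μ f z * (((lev L k : ℕ) : ℂ) * (sG f g (z + Pi.single μ 1) z' - sG f g z z')), ?_⟩
  have e : ∀ t, (Pmodel L (cubic d (side t)) (V t) k * G t) (castT (cubic d (lev L k * side t)) z, f) (castT (cubic d (lev L k * side t)) z', g)
      = ∑ μ, V t k μ (castT (cubic d (lev L k * side t)) z, f) * (((lev L k : ℕ) : ℂ) *
          (G t (castT (cubic d (lev L k * side t)) (z + Pi.single μ 1), f) (castT (cubic d (lev L k * side t)) z', g)
            - G t (castT (cubic d (lev L k * side t)) z, f) (castT (cubic d (lev L k * side t)) z', g))) := by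
    intro t
    rw [Pmodel_mul_apply]
    refine Finset.sum_congr rfl fun μ _ => ?_
    rw [castT_add, castT_single]
    rfl
  simp only [e]
  exact tendsto_finsetSum _ fun μ _ => (hsV μ f z).mul (((hsG f g (z + Pi.single μ 1) z').sub (hsG f g z z')).const_mul _)

end AnyVolume

/-! ## §3 The perturbed fine propagator `(Δ_a^{(k)} + u·P^{(k)})⁻¹ = 𝒢^{(k)}·(1 + u·P𝒢^{(k)})⁻¹` and its pair entry limits -/

section Perturbed

variable (a : ℝ) (ha : 0 < a)

/-- **`(Δ_a^{(k)} + u·P)⁻¹ = 𝒢^{(k)}·(1 + u·P·𝒢^{(k)})⁻¹`** (any torus, any `P`): `Δ_a + uP = (1 + u·PΔ_a⁻¹)·Δ_a` and `Δ_a⁻¹ = 𝒢`. [folklore] -/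
theorem pertInv_eq (M : Fin d → ℕ) [∀ μ, NeZero (M μ)] (k : ℕ) (P : Matrix (idx L M k) (idx L M k) ℂ) (u : ℂ) :
    (calDalev L M a ha k + u • P)⁻¹ = calGlev L M a ha k * (1 + u • (P * calGlev L M a ha k))⁻¹ := by
  rw [add_smul_eq_mul_right (P := P) (isUnit_det_calDalev L M a ha k) u, Matrix.mul_inv_rev, calDalev_inv]

omit [NeZero L] in
/-- `1 − 1•(1 + u•X) = (−u)•X`. [folklore] -/
theorem one_sub_one_smul {ι : Type*} [DecidableEq ι] (X : Matrix ι ι ℂ) (u : ℂ) : (1 : Matrix ι ι ℂ) - (1 : ℂ) • (1 + u • X) = (-u) • X := by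
  rw [one_smul, sub_add_cancel_left, neg_smul]

omit [NeZero L] in
/-- `1 + u•X = 1 − (−u)•X`. [folklore] -/
theorem one_add_smul_eq {ι : Type*} [DecidableEq ι] (X : Matrix ι ι ℂ) (u : ℂ) : (1 : Matrix ι ι ℂ) + u • X = 1 - (-u) • X := by
  rw [neg_smul, sub_neg_eq_add]

/-- **`tendsto_pertInv_pair` — EL₂ OF THE PERTURBED FINE PROPAGATOR, MODULO THE BACKGROUND's POINTWISE LIMIT** [our proof] (`d ≥ 3`, `a > 0`, level `k`, along the even cubic volumes
`2(t+1)`; `κ₀ = d(α+β)Cst`): for a volume-indexed family of backgrounds with `LipschitzBackground L (cubic d (2(t+1))) (V t) α β` (constants uniform in the volume) whose level-`k`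
readings converge at every fine integer point (EL₁ — DISPLAYED), and every coupling `‖u‖ ≤ T` with `T·κ₀ < 1`, the perturbed fine propagator has pair entry limits:
`∀ f g z z′, ∃ s, (Δ_a^{(k)} + u·P(V_t)^{(k)})⁻¹((ẑ_t,f),(ẑ′_t,g)) → s`.  Route: `𝒢·(1 + u·P𝒢)⁻¹`; PART 144 on `A_t = 1 + u·P𝒢` ((a) `‖1 − A_t‖ ≤ Tκ₀`, (b) §1's decay, (c) §2's EL₂),
then PART 144's left-decaying pair product with `𝒢`. [cite: Balaban1987RG1, p.264 (after (1.21): the `T ↗ ℤ^d` limit)] -/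
theorem tendsto_pertInv_pair (hd : 3 ≤ d) {α β T : ℝ} (hT : T * (d * (α + β) * Cst d a) < 1) (k : ℕ)
    {V : (t : ℕ) → (k : ℕ) → Fin d → (idx L (cubic d (evenPeriod t)) k → ℂ)} (hV : ∀ t, LipschitzBackground L (cubic d (evenPeriod t)) (V t) α β)
    (hV1 : ∀ (μ f : Fin d) (z : Fin d → ℤ), ∃ s : ℂ, Tendsto (fun t => V t k μ (castT (cubic d (lev L k * evenPeriod t)) z, f)) atTop (𝓝 s))
    {u : ℂ} (hu : ‖u‖ ≤ T) (f g : Fin d) (z z' : Fin d → ℤ) :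
    ∃ s : ℂ, Tendsto (fun t => (calDalev L (cubic d (evenPeriod t)) a ha k + u • Pmodel L (cubic d (evenPeriod t)) (V t) k)⁻¹
      (castT (cubic d (lev L k * evenPeriod t)) z, f) (castT (cubic d (lev L k * evenPeriod t)) z', g)) atTop (𝓝 s) := by
  have hd1 : 1 ≤ d := le_trans (by norm_num) hd
  have hd0 : (0 : ℝ) < d := by exact_mod_cast lt_of_lt_of_le zero_lt_one hd1
  have hn : (0 : ℝ) < lev L k := by exact_mod_cast Nat.pos_of_ne_zero (NeZero.ne (lev L k))
  have hside : Tendsto (fun t => lev L k * evenPeriod t) atTop atTop :=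
    Filter.Tendsto.const_mul_atTop' (Nat.pos_of_ne_zero (NeZero.ne (lev L k))) tendsto_evenPeriod |>.congr fun t => by ring
  set κ₀ : ℝ := d * (α + β) * Cst d a with hκ₀
  have hαβ : 0 ≤ α ∧ 0 ≤ β := (hV 0).nonneg
  have hκ₀0 : 0 ≤ κ₀ := by have := Cst_nonneg d a; have := hαβ.1; have := hαβ.2; positivity
  have hT0 : 0 ≤ T := (norm_nonneg u).trans hu
  have huκ : ‖u‖ * κ₀ ≤ T * κ₀ := mul_le_mul_of_nonneg_right hu hκ₀0
  -- the fine window decay of `𝒢` (PART 145), on the right and on the left, and its EL₂ (PART 146)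
  obtain ⟨κ, C, hκ, hC, hdec⟩ := exists_fineWindowDecay_calGlev L a ha
  have hδ : 0 < κ / (d * lev L k) := div_pos hκ (mul_pos hd0 hn)
  have hGr : ∀ t (w : Site d (lev L k * evenPeriod t)) (g : Fin d) (y : Site d (lev L k * evenPeriod t)) (h : Fin d),
      ‖calGlev L (cubic d (evenPeriod t)) a ha k (w, g) (y, h)‖ ≤ C * Real.exp (-(κ / (d * lev L k)) * l1 (windowMap d (lev L k * evenPeriod t) (w - y))) :=
    fun t w g y h => hdec (evenPeriod t) k w y g h
  have hGl : ∀ t (x : Site d (lev L k * evenPeriod t)) (f : Fin d) (w : Site d (lev L k * evenPeriod t)) (g : Fin d),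
      ‖calGlev L (cubic d (evenPeriod t)) a ha k (x, f) (w, g)‖ ≤ C * Real.exp (-(κ / (d * lev L k)) * l1 (windowMap d (lev L k * evenPeriod t) (w - x))) := by
    intro t x f w g
    have h := hdec (evenPeriod t) k x w f g
    rwa [show x - w = -(w - x) from (neg_sub w x).symm, l1_windowMap_neg] at h
  have hGel := fun f g w w' => tendsto_calGlev_pair L a ha hd k f g w w'
  -- `X_t = P(V_t)·𝒢`: window decay (§1) and EL₂ (§2)
  set CX : ℝ := d * (α * lev L k * ((Real.exp (3 * (κ / (d * lev L k))) + 1) * C)) with hCX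
  have hCX0 : 0 ≤ CX := by have := hαβ.1; positivity
  have hXdec : ∀ t (w : Site d (lev L k * evenPeriod t)) (g : Fin d) (y : Site d (lev L k * evenPeriod t)) (h : Fin d),
      ‖(Pmodel L (cubic d (evenPeriod t)) (V t) k * calGlev L (cubic d (evenPeriod t)) a ha k) (w, g) (y, h)‖
        ≤ CX * Real.exp (-(κ / (d * lev L k)) * l1 (windowMap d (lev L k * evenPeriod t) (w - y))) :=
    fun t w g y h => norm_Pmodel_mul_apply_le L (evenPeriod t) (hV t) k hC hδ.le (hGr t) w g y h
  have hXel := tendsto_Pmodel_mul_pair L (side := evenPeriod) k V hV1 (G := fun t => calGlev L (cubic d (evenPeriod t)) a ha k) hGel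
  -- `A_t = 1 + u·X_t`: (a) Neumann ratio, (b) window decay, (c) EL₂
  have hXop : ∀ t, ‖Pmodel L (cubic d (evenPeriod t)) (V t) k * calGlev L (cubic d (evenPeriod t)) a ha k‖ ≤ κ₀ := by
    intro t
    have h := (perturbationLaws_firstOrder L (cubic d (evenPeriod t)) a ha hd1 (hV t)).opNorm_P_mul_inv_le k
    rwa [calDalev_inv] at h
  have hAq : ∀ t, ‖(1 : Matrix (idx L (cubic d (evenPeriod t)) k) (idx L (cubic d (evenPeriod t)) k) ℂ)
      - (1 : ℂ) • (1 + u • (Pmodel L (cubic d (evenPeriod t)) (V t) k * calGlev L (cubic d (evenPeriod t)) a ha k))‖ ≤ T * κ₀ := by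
    intro t
    rw [one_sub_one_smul, neg_smul, norm_neg]
    exact (opNorm_smul_le_of_le (hXop t) u).trans huκ
  have hAdec : ∀ t (w : Site d (lev L k * evenPeriod t)) (g : Fin d) (y : Site d (lev L k * evenPeriod t)) (h : Fin d),
      ‖((1 : Matrix (idx L (cubic d (evenPeriod t)) k) (idx L (cubic d (evenPeriod t)) k) ℂ)
          + u • (Pmodel L (cubic d (evenPeriod t)) (V t) k * calGlev L (cubic d (evenPeriod t)) a ha k)) (w, g) (y, h)‖
        ≤ (1 + ‖-u‖ * CX) * Real.exp (-(κ / (d * lev L k)) * l1 (windowMap d (lev L k * evenPeriod t) (w - y))) := by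
    intro t w g y h
    rw [one_add_smul_eq]
    exact norm_one_sub_smul_apply_le (lev L k * evenPeriod t) (-u) (hXdec t) w g y h
  have hAel : ∀ (f g : Fin d) (z z' : Fin d → ℤ), ∃ s : ℂ, Tendsto (fun t => ((1 : Matrix (idx L (cubic d (evenPeriod t)) k) (idx L (cubic d (evenPeriod t)) k) ℂ)
        + u • (Pmodel L (cubic d (evenPeriod t)) (V t) k * calGlev L (cubic d (evenPeriod t)) a ha k))
      (castT (cubic d (lev L k * evenPeriod t)) z, f) (castT (cubic d (lev L k * evenPeriod t)) z', g)) atTop (𝓝 s) := by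
    intro f g z z'
    obtain ⟨s, hs⟩ := tendsto_one_sub_smul_pair (d := d) (F := Fin d) (side := fun t => lev L k * evenPeriod t) hside (-u) hXel f g z z'
    refine ⟨s, hs.congr fun t => ?_⟩
    rw [← one_add_smul_eq]
  have hAinv := exists_tendsto_inv_pair (d := d) (F := Fin d) (side := fun t => lev L k * evenPeriod t) hside
    (A := fun t => (1 : Matrix (idx L (cubic d (evenPeriod t)) k) (idx L (cubic d (evenPeriod t)) k) ℂ)
      + u • (Pmodel L (cubic d (evenPeriod t)) (V t) k * calGlev L (cubic d (evenPeriod t)) a ha k)) (τ := 1) hAq hT hAdec hδ hAel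
  -- `A_t⁻¹` is entrywise bounded by the Neumann bound
  have hAinvb : ∀ t (w : Site d (lev L k * evenPeriod t)) (g : Fin d) (y : Site d (lev L k * evenPeriod t)) (h : Fin d),
      ‖((1 : Matrix (idx L (cubic d (evenPeriod t)) k) (idx L (cubic d (evenPeriod t)) k) ℂ)
          + u • (Pmodel L (cubic d (evenPeriod t)) (V t) k * calGlev L (cubic d (evenPeriod t)) a ha k))⁻¹ (w, g) (y, h)‖ ≤ (1 - T * κ₀)⁻¹ :=
    fun t w g y h => (norm_entry_le_opNorm _ _ _).trans (opNorm_inv_one_add_le ((opNorm_smul_le_of_le (hXop t) u).trans huκ) hT)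
  -- `(Δ_a + uP)⁻¹ = 𝒢·A_t⁻¹`: pair product, left factor decaying
  obtain ⟨s, hs⟩ := tendsto_mul_pair' (d := d) (F := Fin d) (side := fun t => lev L k * evenPeriod t) hside
    (X := fun t => calGlev L (cubic d (evenPeriod t)) a ha k)
    (Y := fun t => ((1 : Matrix (idx L (cubic d (evenPeriod t)) k) (idx L (cubic d (evenPeriod t)) k) ℂ)
      + u • (Pmodel L (cubic d (evenPeriod t)) (V t) k * calGlev L (cubic d (evenPeriod t)) a ha k))⁻¹) hGl hδ hAinvb hGel hAinv f g z z'
  refine ⟨s, hs.congr fun t => ?_⟩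
  rw [pertInv_eq]

/-! ## §4 The perturbed block covariance `c_k(u)` on the unit lattice -/

/-- **`tendsto_avgTow_pair_of_fine` — THE UNIT-LATTICE STENCIL, MIDDLE-FREE** [folklore]: along any family of cubic volumes, if the middle kernel `X_t k` has pair entry limits at fine
integer readings (EL₂ at level `k`), then `L^{dk}·Q_kX_tQ_kᴴ = avgTow QBlev (L^d) X_t k` read through `e = unitIdx` has pair entry limits at unit integer readings — every entry is a FIXED
finite combination of middle entries at fine integer readings (PART 138's `QvOp` stencil; PART 146's argument with the middle kernel abstracted). -/
theorem tendsto_avgTow_pair_of_fine {side : ℕ → ℕ} [∀ t, NeZero (side t)] (k : ℕ)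
    {X : (t : ℕ) → (k' : ℕ) → Matrix (idx L (cubic d (side t)) k') (idx L (cubic d (side t)) k') ℂ}
    (hXel : ∀ (f g : Fin d) (z z' : Fin d → ℤ), ∃ s : ℂ,
      Tendsto (fun t => X t k (castT (cubic d (lev L k * side t)) z, f) (castT (cubic d (lev L k * side t)) z', g)) atTop (𝓝 s))
    (μ ν : Fin d) (z z' : Fin d → ℤ) :
    ∃ s : ℂ, Tendsto (fun t => Matrix.reindex (unitIdx L (cubic d (side t))) (unitIdx L (cubic d (side t)))
        (avgTow (QBlev L (cubic d (side t))) ((L : ℝ) ^ d) (X t) k) (castT (cubic d (side t)) z, μ) (castT (cubic d (side t)) z', ν)) atTop (𝓝 s) := by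
  have hterm : ∀ (j : Fin d → Fin (lev L k)) (t₁ : Fin (lev L k)) (j' : Fin d → Fin (lev L k)) (t₂ : Fin (lev L k)), ∃ s : ℂ,
      Tendsto (fun t => X t k
          (bpt (lev L k) (cubic d (side t)) (castT (cubic d (side t)) z) j + tstep (fine (lev L k) (cubic d (side t))) μ t₁, μ)
          (bpt (lev L k) (cubic d (side t)) (castT (cubic d (side t)) z') j' + tstep (fine (lev L k) (cubic d (side t))) ν t₂, ν)) atTop (𝓝 s) := by
    intro j t₁ j' t₂
    obtain ⟨s, hs⟩ := hXel μ ν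
      (fun i => (lev L k : ℤ) * z i + ((j i : ℕ) : ℤ) + if i = μ then ((t₁ : ℕ) : ℤ) else 0)
      (fun i => (lev L k : ℤ) * z' i + ((j' i : ℕ) : ℤ) + if i = ν then ((t₂ : ℕ) : ℤ) else 0)
    refine ⟨s, hs.congr fun t => ?_⟩
    rw [bpt_castT_add_tstep, bpt_castT_add_tstep]
  choose sv hsv using hterm
  refine ⟨_, (Tendsto.const_mul (((((L : ℝ) ^ d) ^ k : ℝ) : ℂ) * (1 / ((lev L k : ℕ) : ℂ) ^ (d + 1) * (1 / ((lev L k : ℕ) : ℂ) ^ (d + 1))))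
    (tendsto_finsetSum Finset.univ fun j _ => tendsto_finsetSum Finset.univ fun t₁ _ => tendsto_finsetSum Finset.univ fun j' _ =>
      tendsto_finsetSum Finset.univ fun t₂ _ => hsv j t₁ j' t₂)).congr fun t => ?_⟩
  rw [reindex_avgTow_eq, Matrix.smul_apply, smul_eq_mul, QGQ_apply]
  ring

/-- **`tendsto_pertCov_pair` — EL₂ OF THE PERTURBED BLOCK COVARIANCE `c_k(u) = L^{dk}Q_k(Δ_a^{(k)} + u·P(V_t)^{(k)})⁻¹Q_kᴴ` ON THE UNIT LATTICE, MODULO THE BACKGROUND's POINTWISE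
LIMIT** [our proof] (hypotheses of `tendsto_pertInv_pair`): `∀ μ ν z z′, ∃ s, c_k(u)(e(ẑ_t,μ), e(ẑ′_t,ν)) → s` along the even cubic volumes — the (c) input of PART 144 for
`c_k(u)⁻¹` (PART 152). [cite: Balaban1987RG1, p.264 (after (1.21): the `T ↗ ℤ^d` limit)] -/
theorem tendsto_pertCov_pair (hd : 3 ≤ d) {α β T : ℝ} (hT : T * (d * (α + β) * Cst d a) < 1) (k : ℕ)
    {V : (t : ℕ) → (k : ℕ) → Fin d → (idx L (cubic d (evenPeriod t)) k → ℂ)} (hV : ∀ t, LipschitzBackground L (cubic d (evenPeriod t)) (V t) α β)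
    (hV1 : ∀ (μ f : Fin d) (z : Fin d → ℤ), ∃ s : ℂ, Tendsto (fun t => V t k μ (castT (cubic d (lev L k * evenPeriod t)) z, f)) atTop (𝓝 s))
    {u : ℂ} (hu : ‖u‖ ≤ T) (μ ν : Fin d) (z z' : Fin d → ℤ) :
    ∃ s : ℂ, Tendsto (fun t => Matrix.reindex (unitIdx L (cubic d (evenPeriod t))) (unitIdx L (cubic d (evenPeriod t)))
        (avgTow (QBlev L (cubic d (evenPeriod t))) ((L : ℝ) ^ d)
          (fun k' => (calDalev L (cubic d (evenPeriod t)) a ha k' + u • Pmodel L (cubic d (evenPeriod t)) (V t) k')⁻¹) k)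
        (castT (cubic d (evenPeriod t)) z, μ) (castT (cubic d (evenPeriod t)) z', ν)) atTop (𝓝 s) :=
  tendsto_avgTow_pair_of_fine L k
    (X := fun t k' => (calDalev L (cubic d (evenPeriod t)) a ha k' + u • Pmodel L (cubic d (evenPeriod t)) (V t) k')⁻¹)
    (fun f g w w' => tendsto_pertInv_pair L a ha hd hT k hV hV1 hu f g w w') μ ν z z'

end Perturbed

end Summit.QuantumFields.BalabanUV.Beta.GAN24.PerturbedPropagatorVolumeLimit

end
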